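import Summits.ABC.IUTFork.Cor312OrbitExcursionModel
import Summits.ABC.IUTFork.Cor312StatementBridges
import Summits.ABC.IUTFork.Cor312LogKummerRoute
import HarnessLib

/-!
# [IUTchIII] Cor. 3.12 — the ORBIT-EXCURSION bed P♮ₑ (honest graded split model), III: typed Thm. 3.11, the orbit, the hull, the two volumes

Proof-only file (D-0012; no `Prop` fact; one bookkeeping definition `moveLast`) of the abc-iut cell (IUT REPAIR branch B, sub-cell B4
Dupuy–Hilado, seat abc-iut-rp-h3 gen 2; rung LADDER-ABC:A2.B), sequel of `Cor312OrbitExcursionBoxes` / `Cor312OrbitExcursionModel` (the model data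
P♮ₑ). TAKES NO SIDE on [IUTchIII] Cor. 3.12. PROVED HERE: §7 the average-depth log-volume `excVol` is MONOTONE and INVARIANT under every family
acting by capsule permutations — so abc-iut-c312-1's Step (x) side condition `LogvolInvariant` holds NON-trivially (graded boxes MOVE) —; §8 the
pilot points: coordinates (`coord_pilotPt`: the value through the bad summand of the last factor, `0` otherwise), honest sub-packet membership
([IUTchIII] Prop. 3.4 (ii)), depth profile read by `gradedRegion` = `lastDepth` (Θ: depth `j²`, q: depth `1`); §9 the typed [IUTchIII] Theorem
3.11 (i) ∧ (ii) ∧ (iii) HOLDS (`excFull_statement`); §10 pilots = exponent `1`, Θ-region `gbox (lastDepth j j²)`, q-region `gbox (lastDepth j 1)`,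
EVERY possible image a permuted graded box, the (Ind1)-families `permFamily (moveLast i)` carry the Θ-box to the boxes deep on `{c | c(i) = true}`
(an EXCURSION: the Θ-box is not stable), the hull `ⁿ˒°𝒰_{j,v_ℚ} = gbox (topDepth j j²)` (deep ONLY on `c ≡ true`: `depthAt_sUnion_possibleImages`);
§11 the volumes: q-volume `−1/2` at BOTH labels (label-independent), Θ-volume `−j²/2 = j²·(q-volume)` (HONEST `j²`-scaling), hull volume
`−j²/2^{j+1}` (`−1/4`, `−1/2`), `−|log(Θ)|` finite (part IV: `−|log(q)| = −1/2 < −3/8 = −|log(Θ)|`, the printed Statement STRICT, bridge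
hypotheses, pins, honesty vector, witness). Interface-level toy of the MECHANISM «isometric shell-fixing (Ind1) + fine polydisc frame ⟹ hull inflation» ([IUTchIV]
Thm. 1.10 Step (v); DH-II §6.2); [claim: Mochizuki2012, status: disputed] for every IUT noun. [cite: DupuyHilado2020, §4.7, §6.2]
-/

noncomputable section

open Set

namespace Summit.ABC.IUTFork.Cor312Vol

namespace ExcursionWitness

open Thm311 Cor312 Cor312.IdentifiedNonVacuity NaiveWitness PinnedWitness SplitWitness Literature.IUT.LogThetaLattice

/-! ## 7. The log-volume: monotone, permutation-invariant (Step (x) non-trivially) -/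

/-- The log-volume is nonpositive. [folklore] -/
theorem excVol_nonpos {j : splitIndex.Label} {vQ : splitIndex.VQ} (U : Set (splitShells.Packet j vQ)) : excVol j vQ U ≤ 0 := by
  unfold excVol; split_ifs
  · have : (0 : ℝ) ≤ ∑ c, (depthAt U c : ℝ) := Finset.sum_nonneg fun c _ => Nat.cast_nonneg _
    have h2 : (0 : ℝ) < 2 ^ ((j : ℕ) + 1) := by positivity
    exact div_nonpos_of_nonpos_of_nonneg (by linarith) h2.le
  · exact le_rfl

/-- **The log-volume is MONOTONE** on all regions (depths are antitone). [folklore] -/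
theorem excVol_mono {j : splitIndex.Label} {vQ : splitIndex.VQ} {U U' : Set (splitShells.Packet j vQ)} (h : U ⊆ U') :
    excVol j vQ U ≤ excVol j vQ U' := by
  by_cases h' : U' ⊆ gbox 0
  · have hU : U ⊆ gbox 0 := h.trans h'
    unfold excVol; rw [if_pos hU, if_pos h']
    have hs : ∑ c, (depthAt U' c : ℝ) ≤ ∑ c, (depthAt U c : ℝ) :=
      Finset.sum_le_sum fun c _ => by exact_mod_cast depthAt_antitone h c
    have h2 : (0 : ℝ) < 2 ^ ((j : ℕ) + 1) := by positivity
    exact div_le_div_of_nonneg_right (by linarith) h2.le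
  · have e : excVol j vQ U' = 0 := by unfold excVol; rw [if_neg h']
    rw [e]; exact excVol_nonpos U

/-- Reindexing a sum over the coordinates along `c ↦ c ∘ σ`. [folklore] -/
theorem sum_comp_perm {j : splitIndex.Label} (σ : Equiv.Perm (splitIndex.Caps j)) (f : (splitIndex.Caps j → Bool) → ℝ) :
    ∑ c, f (c ∘ ⇑σ) = ∑ c, f c :=
  Fintype.sum_equiv ⟨fun c => c ∘ ⇑σ, fun c => c ∘ ⇑σ.symm, fun c => funext fun i => by simp, fun c => funext fun i => by simp⟩ _ _
    fun _ => rfl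

/-- A family acting by `σ` preserves boundedness (the unit box is carried onto itself). [folklore] -/
theorem image_subset_gbox_zero_iff {Φ : splitShells.PacketAut} {j : splitIndex.Label} {vQ : splitIndex.VQ} {σ : Equiv.Perm (splitIndex.Caps j)}
    (hΦ : ∀ x, Φ j vQ x = splitShells.permute j vQ σ x) (U : Set (splitShells.Packet j vQ)) : Φ j vQ '' U ⊆ gbox 0 ↔ U ⊆ gbox 0 := by
  constructor
  · intro h x hx c
    have h1 := (image_subset_slab_iff hΦ U (c ∘ ⇑σ.symm) 0).1 (h.trans (gbox_subset_slab 0 _)) hx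
    have e : (c ∘ ⇑σ.symm) ∘ ⇑σ = c := funext fun i => by simp
    rw [e] at h1; exact h1
  · intro h y hy c
    exact (image_subset_slab_iff hΦ U c 0).2 (h.trans (gbox_subset_slab 0 _)) hy

/-- **The log-volume is INVARIANT under every family acting by capsule permutations** — in particular under every element of
⟨(Ind1)∪(Ind2)⟩ (`SplitWitness.actsByPerm_of_mem_closure`): Step (x) of the printed proof in P♮ₑ, NON-trivially (graded boxes move).
[folklore] -/
theorem excVol_image_of_perm {Φ : splitShells.PacketAut} {j : splitIndex.Label} {vQ : splitIndex.VQ} {σ : Equiv.Perm (splitIndex.Caps j)}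
    (hΦ : ∀ x, Φ j vQ x = splitShells.permute j vQ σ x) (U : Set (splitShells.Packet j vQ)) : excVol j vQ (Φ j vQ '' U) = excVol j vQ U := by
  unfold excVol
  by_cases hU : U ⊆ gbox 0
  · rw [if_pos ((image_subset_gbox_zero_iff hΦ U).2 hU), if_pos hU]
    simp only [depthAt_image_of_perm hΦ]
    rw [sum_comp_perm σ fun c => (depthAt U c : ℝ)]
  · rw [if_neg (fun h => hU ((image_subset_gbox_zero_iff hΦ U).1 h)), if_neg hU]

/-- `LogvolInvariant` of the data of P♮ₑ (abc-iut-c312-1's Step (x) side condition), PROVED. [folklore] -/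
theorem excData_logvolInvariant : excData.LogvolInvariant := fun Φ hΦ j vQ A _ => by
  have hp : ActsByPerm Φ := by
    rcases hΦ with h1 | h2
    · exact actsByPerm_of_mem_Ind1Family h1
    · exact actsByPerm_of_mem_Ind2Family h2
  obtain ⟨σ, hσ⟩ := hp j vQ
  exact excVol_image_of_perm hσ A

/-! ## 8. The pilot points: coordinates, sub-packet, depth profile -/

/-- **The coordinates of a pilot point**: `coord c (pilotPt t) = t` if `c` passes through the bad summand of the last factor (`c(j) = true`),
`0` otherwise. [folklore] -/
theorem coord_pilotPt (t : ℚ) (j : splitIndex.Label) (vQ : splitIndex.VQ) (c : splitIndex.Caps j → Bool) :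
    coord j vQ c (pilotPt t j vQ) = if c (Fin.last _) = true then t else 0 := by
  unfold pilotPt LogShells.tprod
  rw [coord_tprod, Fin.prod_univ_castSucc]
  have h1 : ∀ i : Fin (j : ℕ), pilotFn t j vQ (Fin.castSucc i) (fib vQ (c (Fin.castSucc i))) = 1 := fun i => by
    unfold pilotFn; rw [if_neg (Fin.castSucc_lt_last i).ne]
  have h2 : pilotFn t j vQ (Fin.last _) (fib vQ (c (Fin.last _))) = if c (Fin.last _) = true then t else 0 := by
    unfold pilotFn; rw [if_pos rfl]; rfl
  simp only [h1, h2, Finset.prod_const_one, one_mul]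

/-- A pilot point lies in the SUB-PACKET `𝓘^ℚ(^{S^±_{j+1},j};−)_v` of the bad valuation: its last factor is supported on the summand `v = true`
([IUTchIII] Prop. 3.4 (ii): the splitting monoid «as a subset of ∏_j 𝓘^ℚ(^{S^±_{j+1},j};𝒟^⊢_v)»). [folklore] -/
theorem pilotPt_mem_subPacket (t : ℚ) (j : splitIndex.Label) : pilotPt t j () ∈ splitShells.SubPacket j true := by
  refine Submodule.subset_span ⟨pilotFn t j (), fun w hw => ?_, rfl⟩
  show pilotFn t j () (Fin.last _) w = 0
  unfold pilotFn
  rw [if_pos rfl, if_neg]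
  exact fun h => hw h

/-- A pilot point is bounded: it lies in the unit box when `|t| ≤ 1`. [folklore] -/
theorem pilotPt_mem_gbox_zero {t : ℚ} (ht : |t| ≤ 1) (j : splitIndex.Label) (vQ : splitIndex.VQ) :
    pilotPt t j vQ ∈ (gbox 0 : Set (splitShells.Packet j vQ)) := fun c => by
  show |coord j vQ c (pilotPt t j vQ)| * (2 : ℚ) ^ (0 : ℕ) ≤ 1
  rw [coord_pilotPt, pow_zero, mul_one]
  split_ifs
  · exact ht
  · rw [abs_zero]; exact zero_le_one

/-- The singleton of the pilot point `pilotPt (2^{−e})` lies in the slab of depth `d` on a coordinate through the bad summand iff `d ≤ e`.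
[folklore] -/
theorem singleton_pilotPt_subset_slab_iff {j : splitIndex.Label} (vQ : splitIndex.VQ) (e d : ℕ) {c : splitIndex.Caps j → Bool}
    (hc : c (Fin.last _) = true) :
    ({pilotPt ((2 : ℚ)⁻¹ ^ e) j vQ} : Set (splitShells.Packet j vQ)) ⊆ slab c d ↔ d ≤ e := by
  rw [Set.singleton_subset_iff]
  show |coord j vQ c _| * (2 : ℚ) ^ d ≤ 1 ↔ _
  rw [coord_pilotPt, if_pos hc, abs_of_nonneg (by positivity), inv_pow, inv_mul_le_iff₀ (by positivity), mul_one]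
  exact pow_le_pow_iff_right₀ (by norm_num : (1 : ℚ) < 2)

/-- **The depth profile of the pilot point `pilotPt (2^{−e})` is `lastDepth j e`** (`e ≤ K`): depth `e` through the bad summand of the
last factor, `0` elsewhere (where its coordinate vanishes). [folklore] -/
theorem pointDepth_pilotPt {j : splitIndex.Label} (vQ : splitIndex.VQ) {e : ℕ} (he : e ≤ K) (c : splitIndex.Caps j → Bool) :
    pointDepth (pilotPt ((2 : ℚ)⁻¹ ^ e) j vQ) c = lastDepth j e c := by
  unfold pointDepth lastDepth
  rw [coord_pilotPt]
  by_cases hc : c (Fin.last _) = true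
  · rw [if_pos hc, if_pos hc, if_neg (by positivity)]
    exact depthAt_eq ((singleton_pilotPt_subset_slab_iff vQ e e hc).2 le_rfl) he fun h =>
      absurd ((singleton_pilotPt_subset_slab_iff vQ e (e + 1) hc).1 h) (by omega)
  · rw [if_neg hc, if_neg hc, if_pos rfl]

/-- At the zero label every graded region is the unit box. [folklore] -/
theorem gradedRegion_zero (Ψ : ∀ v : splitIndex.V, v ∈ splitIndex.Vbad → Set (splitShells.StarPacket v)) (vQ : splitIndex.VQ) :
    gradedRegion Ψ 0 vQ = gbox 0 := dif_pos rfl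

/-- **The graded region of the Θ-datum at a label of `𝔽_l^⋇` is `gbox (lastDepth j j²)`.** [folklore] -/
theorem gradedRegion_theta {j : splitIndex.Label} (hj : j ≠ 0) (vQ : splitIndex.VQ) :
    gradedRegion (fun v _ => {thetaStarE v}) j vQ = gbox (lastDepth j ((j : ℕ) ^ 2)) := by
  unfold gradedRegion; rw [dif_neg hj]
  simp only [Set.mem_singleton_iff, Set.iUnion_iUnion_eq_left]
  exact congrArg gbox (funext fun c => pointDepth_pilotPt vQ (sq_le_K j) c)

/-- **The graded region of the q-datum at a label of `𝔽_l^⋇` is `gbox (lastDepth j 1)`.** [folklore] -/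
theorem gradedRegion_q {j : splitIndex.Label} (hj : j ≠ 0) (vQ : splitIndex.VQ) : gradedRegion qDatumE j vQ = gbox (lastDepth j 1) := by
  unfold gradedRegion qDatumE; rw [dif_neg hj]
  simp only [Set.mem_singleton_iff, Set.iUnion_iUnion_eq_left]
  refine congrArg gbox (funext fun c => ?_)
  have h := pointDepth_pilotPt vQ (j := j) (e := 1) (by decide) c
  rw [pow_one] at h; exact h

/-! ## 9. The typed Theorem 3.11 (i) ∧ (ii) ∧ (iii) HOLDS for P♮ₑ -/

/-- (i): the splitting monoid sits in the sub-packets (HONESTLY: theta value in the last factor on the bad summand); the degree clause (the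
degree IS the global log-volume of the region); the classes `^{n,∘}𝔯^{LGP}` coincide. [folklore] -/
theorem exc_partI : excFull.PartI := by
  refine ⟨fun n v hv x hx j => ?_, fun n j k => ⟨fun vQ => trivial, Set.toFinite _, ?_⟩, fun _ _ => rfl⟩
  · have hv' : v = true := hv
    subst hv'
    rw [show x = thetaStarE true from hx]
    exact pilotPt_mem_subPacket _ j.1
  · show excVol j.1 () (gbox 0) = ∑ᶠ vQ : splitIndex.VQ, excVol j.1 vQ (gbox 0)
    rw [finsum_unique]

/-- (ii), column by column: identity Kummer transport, (Ind3) = `gbox 0 ⊆ gbox 0`, no archimedean place. [folklore] -/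
theorem exc_partII : excFull.toLatticeSituation.PartII := fun _ =>
  (Column.partII_iff _ _).2
    ⟨fun _ _ _ _ _ => ⟨trivial, rfl⟩, fun _ _ _ => rfl, fun _ _ => rfl, fun _ _ _ _ _ => subset_rfl, fun _ _ _ h => absurd trivial h⟩

/-- (iii): the link data are abc-iut-w5-d247's `naiveLink`. [folklore] -/
theorem exc_partIII : excFull.PartIII := by
  refine ⟨naiveLink.partIIIa_holds, naiveLink.partIIIb_holds, ?_, fun n m => Thm311.PolyIsoCalc.stabilized_full _ _,
    excFull.evalCompatUpToInd_of_multiradialCompat exc_partI.2.2⟩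
  refine naiveLink.partIIIc_of_full (fun _ => rfl) fun n m => ?_
  rintro _ ⟨a, rfl⟩
  show unitIso a ≪≫ unitIso ((-1) ^ m.natAbs) = unitIso ((-1) ^ m.natAbs) ≪≫ unitIso a
  rw [unitIso_trans, unitIso_trans, mul_comm]

/-- **The typed Theorem 3.11 (i) ∧ (ii) ∧ (iii) HOLDS in P♮ₑ.** [folklore] -/
theorem excFull_statement : excFull.Statement := ⟨exc_partI, exc_partII, exc_partIII⟩

/-! ## 10. Pilots, regions, the (Ind1)-orbit (an excursion), the hull -/

/-- The pilots are the objects of exponent `1`. [folklore] -/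
theorem excSetting_pilots : excSetting.thetaPilot = (1 : ℤ) ∧ excSetting.qPilot = (1 : ℤ) :=
  ⟨congrArg (Nat.cast : ℕ → ℤ) (expOf_eq_one_of_isGenerator_top (Classical.choose_spec (excSetting.split.exists_gen true rfl))), rfl⟩

/-- The Kummer image of the Θ-pilot at every `(m, j, v_ℚ)` is `thetaGlue 1`. [folklore] -/
theorem excSetting_thetaRegion (m : ℤ) (j : splitIndex.Label) (vQ : splitIndex.VQ) : excSetting.thetaRegion m j vQ = thetaGlue 1 j vQ := by
  unfold Setting.thetaRegion; rw [excSetting_pilots.1]; rfl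

/-- The (Ind3)-enlarged region is the same (no `m`-drift). [folklore] -/
theorem excSetting_thetaRegion3 (j : splitIndex.Label) (vQ : splitIndex.VQ) : excSetting.thetaRegion3 j vQ = thetaGlue 1 j vQ := by
  show (⋃ m : ℤ, excSetting.thetaRegion m j vQ) = _
  simp_rw [excSetting_thetaRegion]; exact Set.iUnion_const _

/-- On `𝔽_l^⋇`: Θ-region `gbox (lastDepth j j²)`, q-region `gbox (lastDepth j 1)`. [folklore] -/
theorem excSetting_regions_of_ne_zero {j : splitIndex.Label} (hj : j ≠ 0) (vQ : splitIndex.VQ) :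
    excSetting.thetaRegion3 j vQ = gbox (lastDepth j ((j : ℕ) ^ 2)) ∧ excSetting.qRegion j vQ = gbox (lastDepth j 1) := by
  rw [excSetting_thetaRegion3, thetaGlue_one_of_ne_zero hj]
  exact ⟨rfl, qGlue_one_of_ne_zero hj vQ⟩

/-- At the zero label both regions are the unit box. [folklore] -/
theorem excSetting_regions_zero (vQ : splitIndex.VQ) : excSetting.thetaRegion3 0 vQ = gbox 0 ∧ excSetting.qRegion 0 vQ = gbox 0 := by
  rw [excSetting_thetaRegion3]; exact ⟨(glue_zero 1 vQ).1, (glue_zero 1 vQ).2⟩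

/-- The capsule permutations MOVING THE LAST INDEX: at every label the transposition of the last capsule index with the index `i (mod j'+1)`
(bookkeeping for the (Ind1)-families of the orbit). [folklore] -/
def moveLast (i : ℕ) : ∀ j' : splitIndex.Label, Equiv.Perm (splitIndex.Caps j') :=
  fun j' => Equiv.swap ⟨i % ((j' : ℕ) + 1), Nat.mod_lt _ (Nat.succ_pos _)⟩ (Fin.last _)

/-- `moveLast i` sends the last capsule index of label `j` to `i`. [folklore] -/
theorem moveLast_apply_last {j : splitIndex.Label} (i : splitIndex.Caps j) : moveLast i.1 j (Fin.last _) = i := by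
  unfold moveLast
  rw [Equiv.swap_apply_right]
  exact Fin.ext (Nat.mod_eq_of_lt i.2)

/-- The (Ind1)-family `permFamily (moveLast i)` lies in ⟨(Ind1)∪(Ind2)⟩ and acts on the packet at `j` by `moveLast i j`. [folklore] -/
theorem moveFamily_mem (i : ℕ) : permFamily (moveLast i) ∈ Setting.indGroup excSituation ∧
    ∀ (j : splitIndex.Label) (vQ : splitIndex.VQ) x, permFamily (moveLast i) j vQ x = splitShells.permute j vQ (moveLast i j) x :=
  ⟨Subgroup.subset_closure (Or.inl (permFamily_mem_Ind1Family _)), fun _ _ _ => rfl⟩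

/-- **Every possible image of the Θ-pilot at a label of `𝔽_l^⋇` is a PERMUTED graded box** `gbox (c ↦ lastDepth j j² (c ∘ σ))`, and for every
capsule index `i` the box deep (`j²`) exactly on `{c | c(i) = true}` IS a possible image (through `permFamily (moveLast i)`). [folklore] -/
theorem excSetting_possibleImages {j : splitIndex.Label} (hj : j ≠ 0) (vQ : splitIndex.VQ) :
    (∀ U ∈ excSetting.possibleImages j vQ, ∃ σ : Equiv.Perm (splitIndex.Caps j), U = gbox fun c => lastDepth j ((j : ℕ) ^ 2) (c ∘ ⇑σ)) ∧
      ∀ i : splitIndex.Caps j, gbox (fun c => if c i = true then (j : ℕ) ^ 2 else 0) ∈ excSetting.possibleImages j vQ := by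
  refine ⟨?_, fun i => ?_⟩
  · rintro U ⟨Φ, hΦ, rfl⟩
    obtain ⟨σ, hσ⟩ := actsByPerm_of_mem_closure hΦ j vQ
    exact ⟨σ, by rw [(excSetting_regions_of_ne_zero hj vQ).1]; exact image_gbox_of_perm hσ _⟩
  · refine ⟨permFamily (moveLast i.1), (moveFamily_mem i.1).1, ?_⟩
    rw [(excSetting_regions_of_ne_zero hj vQ).1, image_gbox_of_perm ((moveFamily_mem i.1).2 j vQ)]
    refine congrArg gbox (funext fun c => ?_)
    unfold lastDepth; rw [Function.comp_apply, moveLast_apply_last]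

/-- The union of the possible images is bounded (inside the unit box) at every label: the hull is defined everywhere. [folklore] -/
theorem excSetting_sUnion_subset (j : splitIndex.Label) (vQ : splitIndex.VQ) : ⋃₀ excSetting.possibleImages j vQ ⊆ gbox 0 := by
  intro x hx
  obtain ⟨U, ⟨Φ, hΦ, rfl⟩, hxU⟩ := hx
  obtain ⟨σ, hσ⟩ := actsByPerm_of_mem_closure hΦ j vQ
  rw [excSetting_thetaRegion3] at hxU
  by_cases hj : j = 0
  · subst hj
    rw [(glue_zero 1 vQ).1, image_gbox_of_perm hσ] at hxU
    exact hxU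
  · rw [thetaGlue_one_of_ne_zero hj, image_gbox_of_perm hσ] at hxU
    exact gbox_antitone (fun c => Nat.zero_le _) hxU

/-- Every union of possible images admits its hull. [folklore] -/
theorem excSetting_hullDefined (j : splitIndex.Label) (vQ : splitIndex.VQ) : excSetting.HullDefined j vQ :=
  ⟨excSetting_sUnion_subset j vQ, trivial⟩

/-- A function which is not constantly `true` takes the value `false` somewhere. [folklore] -/
theorem exists_eq_false_of_ne {j : splitIndex.Label} {c : splitIndex.Caps j → Bool} (hc : c ≠ fun _ => true) : ∃ i, c i = false := by
  obtain ⟨i, hi⟩ := Function.ne_iff.1 hc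
  exact ⟨i, Bool.eq_false_iff.2 hi⟩

/-- **The depth vector of the union of the possible images is `topDepth j j²`**: depth `j²` on `c ≡ true` (every permuted Θ-box is that deep
there; the Θ-box's witness `2^{−j²}·e_{c≡true}` is no deeper), depth `0` on every other coordinate `c` (if `c(i) = false`, the possible image
moved by `moveLast i` contains the unit witness `e_c`). [folklore] -/
theorem depthAt_sUnion_possibleImages {j : splitIndex.Label} (hj : j ≠ 0) (vQ : splitIndex.VQ) (c : splitIndex.Caps j → Bool) :
    depthAt (⋃₀ excSetting.possibleImages j vQ) c = topDepth j ((j : ℕ) ^ 2) c := by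
  unfold topDepth
  by_cases hc : c = fun _ => true
  · rw [if_pos hc]
    have hlast : ∀ σ : Equiv.Perm (splitIndex.Caps j), lastDepth j ((j : ℕ) ^ 2) (c ∘ ⇑σ) = (j : ℕ) ^ 2 := fun σ => by
      subst hc; simp [lastDepth]
    have hc1 : lastDepth j ((j : ℕ) ^ 2) c = (j : ℕ) ^ 2 := by subst hc; simp [lastDepth]
    refine depthAt_eq (Set.sUnion_subset fun U hU => ?_) (sq_le_K j) fun h => ?_
    · obtain ⟨σ, rfl⟩ := (excSetting_possibleImages hj vQ).1 U hU
      intro x hx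
      have h1 : |coord j vQ c x| * (2 : ℚ) ^ lastDepth j ((j : ℕ) ^ 2) (c ∘ ⇑σ) ≤ 1 := hx c
      rw [hlast σ] at h1
      exact h1
    · have hw : ((2 : ℚ)⁻¹ ^ ((j : ℕ) ^ 2)) • ePt j vQ c ∈ ⋃₀ excSetting.possibleImages j vQ := by
        refine Set.subset_sUnion_of_mem (excSetting.thetaRegion3_mem_possibleImages j vQ) ?_
        rw [(excSetting_regions_of_ne_zero hj vQ).1, smul_ePt_mem_gbox_iff, hc1]
        exact (smul_ePt_mem_slab_iff vQ _ c c _).1 ((pow_smul_ePt_mem_slab_iff vQ c _ _).2 le_rfl) rfl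
      have := (pow_smul_ePt_mem_slab_iff vQ c _ _).1 (h hw)
      omega
  · rw [if_neg hc]
    obtain ⟨i, hi⟩ := exists_eq_false_of_ne hc
    refine Nat.le_zero.1 (depthAt_le_of_not_subset fun h => ?_)
    have hw : (1 : ℚ) • ePt j vQ c ∈ ⋃₀ excSetting.possibleImages j vQ := by
      refine Set.subset_sUnion_of_mem ((excSetting_possibleImages hj vQ).2 i) ?_
      rw [smul_ePt_mem_gbox_iff, hi]
      norm_num
    have h1 := (smul_ePt_mem_slab_iff vQ (1 : ℚ) c c (0 + 1)).1 (h hw) rfl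
    norm_num at h1

/-- **The hull `ⁿ˒°𝒰_{j,v_ℚ}` of P♮ₑ is the graded box `gbox (topDepth j j²)`** — deep on the single coordinate `c ≡ true`, strictly LARGER than
every possible image (each is deep `j²` on `2^j` coordinates). [folklore] -/
theorem excSetting_thetaHull {j : splitIndex.Label} (hj : j ≠ 0) (vQ : splitIndex.VQ) :
    excSetting.thetaHull j vQ = gbox (topDepth j ((j : ℕ) ^ 2)) := by
  show (excFrame j vQ).hull _ = _
  rw [excFrame_hull (excSetting_sUnion_subset j vQ)]
  exact congrArg gbox (funext fun c => depthAt_sUnion_possibleImages hj vQ c)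

/-! ## 11. The two local volumes (honest `j²`-scaling, label-independent q-volume) and the hull volume -/

/-- The number of coordinates through the bad summand of the last factor is `2^j`. [folklore] -/
theorem card_filter_last_true (n : ℕ) : (Finset.univ.filter fun c : Fin (n + 1) → Bool => c (Fin.last n) = true).card = 2 ^ n := by
  have e : (Finset.univ.filter fun c : Fin (n + 1) → Bool => c (Fin.last n) = true) =
      Finset.univ.image fun c' : Fin n → Bool => (Fin.snoc c' true : Fin (n + 1) → Bool) := by
    ext c
    simp only [Finset.mem_filter, Finset.mem_univ, true_and, Finset.mem_image]
    constructor
    · intro hc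
      exact ⟨Fin.init c, by rw [← hc]; exact Fin.snoc_init_self c⟩
    · rintro ⟨c', rfl⟩; exact Fin.snoc_last _ _
  rw [e, Finset.card_image_of_injective _ fun a b h => by simpa using congrArg Fin.init h]
  simp

/-- The total depth of `lastDepth j e` is `e·2^j`. [folklore] -/
theorem sum_lastDepth (j : splitIndex.Label) (e : ℕ) : ∑ c, (lastDepth j e c : ℝ) = e * 2 ^ (j : ℕ) := by
  unfold lastDepth
  simp only [Nat.cast_ite, Nat.cast_zero]
  rw [← Finset.sum_filter, Finset.sum_const, card_filter_last_true, nsmul_eq_mul, mul_comm]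
  push_cast; ring

/-- The total depth of `topDepth j e` is `e`. [folklore] -/
theorem sum_topDepth (j : splitIndex.Label) (e : ℕ) : ∑ c, (topDepth j e c : ℝ) = e := by
  unfold topDepth
  simp only [Nat.cast_ite, Nat.cast_zero]
  rw [Finset.sum_ite_eq' Finset.univ (fun _ : splitIndex.Caps j => true) (fun _ => (e : ℝ))]
  simp

/-- The volume of the last-factor box of depth `e ≤ K`: `−e/2` — INDEPENDENT of the label. [folklore] -/
theorem excVol_lastDepth {j : splitIndex.Label} (vQ : splitIndex.VQ) {e : ℕ} (he : e ≤ K) : excVol j vQ (gbox (lastDepth j e)) = -(e : ℝ) / 2 := by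
  rw [excVol_gbox vQ (lastDepth_le_K j he), sum_lastDepth, pow_succ]
  have h2 : (0 : ℝ) < 2 ^ (j : ℕ) := by positivity
  field_simp

/-- The volume of the top box of depth `e ≤ K`: `−e/2^{j+1}`. [folklore] -/
theorem excVol_topDepth {j : splitIndex.Label} (vQ : splitIndex.VQ) {e : ℕ} (he : e ≤ K) :
    excVol j vQ (gbox (topDepth j e)) = -(e : ℝ) / 2 ^ ((j : ℕ) + 1) := by
  rw [excVol_gbox vQ (topDepth_le_K j he), sum_topDepth]

/-- **The local q-volume is `−1/2` at EVERY label of `𝔽_l^⋇`** (label-independence: the READING clause `hindep` of p419757 holds). [folklore] -/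
theorem excSetting_qLocal (i : Fin splitIndex.lstar) (vQ : splitIndex.VQ) : excSetting.qLocal (Setting.labelSucc i) vQ = -1 / 2 := by
  unfold Setting.qLocal
  rw [(excSetting_regions_of_ne_zero (Setting.labelSucc_ne_zero i) vQ).2]
  show excVol _ vQ (gbox (lastDepth _ 1)) = _
  rw [excVol_lastDepth vQ (by decide)]; norm_num

/-- **The volume of EVERY Kummer image of the Θ-pilot at label `j` is `−j²/2 = j²·(q-volume)`** (HONEST `j²`-scaling: the READING clause
`hscaled` of p419757 holds, at every `m` and for the (Ind3)-union). [folklore] -/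
theorem excSetting_thetaVol (m : ℤ) (i : Fin splitIndex.lstar) (vQ : splitIndex.VQ) :
    (excFull.D excSetting.n).logvol _ vQ (excSetting.thetaRegion m (Setting.labelSucc i) vQ) =
        (((i : ℕ) + 1 : ℕ) : ℝ) ^ 2 * excSetting.qLocal (Setting.labelSucc i) vQ ∧
      (excFull.D excSetting.n).logvol _ vQ (excSetting.thetaRegion3 (Setting.labelSucc i) vQ) =
        (((i : ℕ) + 1 : ℕ) : ℝ) ^ 2 * excSetting.qLocal (Setting.labelSucc i) vQ := by
  have hj := Setting.labelSucc_ne_zero i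
  have e : (excFull.D excSetting.n).logvol _ vQ (gbox (lastDepth (Setting.labelSucc i) ((Setting.labelSucc i : ℕ) ^ 2))) =
      (((i : ℕ) + 1 : ℕ) : ℝ) ^ 2 * excSetting.qLocal (Setting.labelSucc i) vQ := by
    show excVol _ vQ _ = _
    rw [excVol_lastDepth vQ (sq_le_K _), excSetting_qLocal]
    have : ((Setting.labelSucc i : ℕ) : ℝ) = (((i : ℕ) + 1 : ℕ) : ℝ) := by simp [Setting.labelSucc, Fin.val_succ]
    push_cast at this ⊢; rw [this]; ring
  rw [excSetting_thetaRegion, ← excSetting_thetaRegion3, (excSetting_regions_of_ne_zero hj vQ).1]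
  exact ⟨e, e⟩

/-- **The local Θ-term is the hull volume `−j²/2^{j+1}`** (`−1/4` at `j = 1`, `−1/2` at `j = 2`). [folklore] -/
theorem excSetting_thetaLocal (i : Fin splitIndex.lstar) (vQ : splitIndex.VQ) :
    excSetting.thetaLocal (Setting.labelSucc i) vQ =
      ((-(((Setting.labelSucc i : ℕ) : ℝ) ^ 2) / 2 ^ ((Setting.labelSucc i : ℕ) + 1) : ℝ) : WithTop ℝ) := by
  have hj := Setting.labelSucc_ne_zero i
  unfold Setting.thetaLocal
  rw [if_pos (excSetting_hullDefined _ vQ)]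
  show ((excVol _ vQ (excSetting.thetaHull (Setting.labelSucc i) vQ) : ℝ) : WithTop ℝ) = _
  rw [excSetting_thetaHull hj, excVol_topDepth vQ (sq_le_K _)]
  congr 1; norm_cast

/-- `−|log(Θ)|` is finite. [folklore] -/
theorem excSetting_thetaFinite : excSetting.ThetaFinite :=
  ⟨fun i vQ => by rw [excSetting_thetaLocal]; exact WithTop.coe_ne_top, fun _ => Set.toFinite _⟩

end ExcursionWitness

end Summit.ABC.IUTFork.Cor312Vol

end
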